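import Literature.MeasureTheory.Lebesgue.PlanarShearSubstitution
import Mathlib.MeasureTheory.Constructions.Pi
import HarnessLib

/-!
# Change of variables for triangular systems of planar shears (Richthammer 2007, §6.6)

Topic `Literature/MeasureTheory/Lebesgue` (namespace `Literature.MeasureTheory.Lebesgue`),
continuation of `PlanarShearSubstitution.lean`. The density of Richthammer's deformed Poisson
process (Lemma 11) is computed, on each cell `A_π` of a fixed selection order, for the "formal
transformation" `T_π(x) = (x_i + t^i_{π,x}(x_i) e₁)_i` of `(ℝ²)^k`, where the translation of the
`j`-th selected particle depends only on the particles selected before it and is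
`1/2`-Lipschitz along `e₁` in its own position: "for `j = k` to `1` we substitute
`x'_i := T^i_{π,x} x_i` … the Lebesgue transformation theorem gives
`dx'_i = dx_i |1 + ∂₁ t^i_{π,x}(x_i)|`. Thus `I(k,π) = [∏_j ∫ dx'_{π(j)}] g(x')`"
[Richthammer2007, §6.6, p. 16]. This file proves that iterated substitution in general.

* `shearMap t x = (x_j + t_j(x) e₁)_j`, `shearJacobian t x = ∏_j (1 + ∂₁ᵉ_j t_j(x))` with the
  everywhere-defined factors `∂₁ᵉ_j t_j(x) = seqDeriv (r ↦ t_j(x + r e₁^{(j)})) 0`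
  (`= ∂₁ t_j` a.e.); `tailShear`, `headShear` — the data with coordinate `0` split off;
* `shearMap_cons`, `shearJacobian_cons` — for TRIANGULAR `t` (`t j x` depends only on the
  coordinates `x i`, `i ≥ j`; coordinate `0` is the particle selected last and is substituted
  first) both split along `x = p :: x'`;
* `lintegral_shearJacobian_mul_comp_shearMap` — **the iterated substitution**: for `t`
  measurable, triangular and `L`-Lipschitz (`L < 1`) along `e₁` in each coordinate, and every
  measurable `u ≥ 0`, `∫ shearJacobian t · u ∘ shearMap t = ∫ u` (induction on `k`: Tonelli, the
  planar rule `lintegral_planarShear` in coordinate `0`, the induction hypothesis for `tailShear t`).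

Any other selection order is reduced to this one by relabelling the coordinates
(`MeasureTheory.measurePreserving_piCongrLeft`), which is left to the user.

## References

* [Richthammer2007] T. Richthammer, *Translation-invariance of two-dimensional Gibbsian point
  processes*, Comm. Math. Phys. 274 (2007) 81–122, arXiv:0706.3637: §6.6 (p. 16).
-/

noncomputable section

namespace Literature.MeasureTheory.Lebesgue

open _root_.MeasureTheory Filter Set Function
open scoped ENNReal NNReal Topology

/-! ### The shear map, its Jacobian factor, and the split data -/

/-- The shear map `T x = (x_j + t_j(x) e₁)_j` of `(ℝ²)^k` (Richthammer's formal transformation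
`T_π`, §6.6). [cite: Richthammer2007, §6.6 (p. 16)] -/
def shearMap {k : ℕ} (t : Fin k → (Fin k → EuclideanSpace ℝ (Fin 2)) → ℝ)
    (x : Fin k → EuclideanSpace ℝ (Fin 2)) : Fin k → EuclideanSpace ℝ (Fin 2) :=
  fun j => x j + t j x • EuclideanSpace.single 0 (1 : ℝ)

/-- The Jacobian factor `∏_j (1 + ∂₁ᵉ_j t_j(x))` of the shear map, with the sequential partial
difference quotients `∂₁ᵉ_j t_j(x) = seqDeriv (r ↦ t_j(x + r e₁^{(j)})) 0` (Richthammer's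
`∏_k |1 + ∂₁ t^k(p^k)|`, (5.6), with `∂₁` replaced by its measurable a.e.-version).
[cite: Richthammer2007, §5.4 (5.6) (p. 11) and §6.6 (p. 16)] -/
def shearJacobian {k : ℕ} (t : Fin k → (Fin k → EuclideanSpace ℝ (Fin 2)) → ℝ)
    (x : Fin k → EuclideanSpace ℝ (Fin 2)) : ℝ≥0∞ :=
  ∏ j, ENNReal.ofReal (1 + seqDeriv (fun r =>
    t j (update x j (x j + r • EuclideanSpace.single 0 (1 : ℝ)))) 0)

/-- The translations of the coordinates `1, …, k` as functions of those coordinates only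
(coordinate `0` frozen at `0`; for triangular `t` its value is irrelevant). [folklore] -/
def tailShear {k : ℕ} (t : Fin (k + 1) → (Fin (k + 1) → EuclideanSpace ℝ (Fin 2)) → ℝ) :
    Fin k → (Fin k → EuclideanSpace ℝ (Fin 2)) → ℝ :=
  fun i x' => t i.succ (Fin.cons 0 x')

/-- The translation of coordinate `0` as a function of the other coordinates and of itself.
[folklore] -/
def headShear {k : ℕ} (t : Fin (k + 1) → (Fin (k + 1) → EuclideanSpace ℝ (Fin 2)) → ℝ)
    (x' : Fin k → EuclideanSpace ℝ (Fin 2)) (p : EuclideanSpace ℝ (Fin 2)) : ℝ :=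
  t 0 (Fin.cons p x')

/-- Unfolding `shearMap`. [folklore] -/
theorem shearMap_apply {k : ℕ} (t : Fin k → (Fin k → EuclideanSpace ℝ (Fin 2)) → ℝ)
    (x : Fin k → EuclideanSpace ℝ (Fin 2)) (j : Fin k) :
    shearMap t x j = x j + t j x • EuclideanSpace.single 0 (1 : ℝ) := rfl

/-- Unfolding `shearJacobian`. [folklore] -/
theorem shearJacobian_def {k : ℕ} (t : Fin k → (Fin k → EuclideanSpace ℝ (Fin 2)) → ℝ)
    (x : Fin k → EuclideanSpace ℝ (Fin 2)) :
    shearJacobian t x = ∏ j, ENNReal.ofReal (1 + seqDeriv (fun r =>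
      t j (update x j (x j + r • EuclideanSpace.single 0 (1 : ℝ)))) 0) := rfl

/-! ### Measurability -/

/-- On `ℝ²`: `p ↦ seqDeriv (r ↦ g(p + r e₁)) 0` is measurable for measurable `g`. [folklore] -/
theorem measurable_seqDeriv_line {g : EuclideanSpace ℝ (Fin 2) → ℝ} (hg : Measurable g) :
    Measurable fun p : EuclideanSpace ℝ (Fin 2) =>
      seqDeriv (fun r => g (p + r • EuclideanSpace.single 0 (1 : ℝ))) 0 := by
  have hterm : ∀ c : ℝ, Measurable fun p : EuclideanSpace ℝ (Fin 2) =>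
      g (p + c • EuclideanSpace.single 0 (1 : ℝ)) := fun c => hg.comp (measurable_id.add_const _)
  unfold seqDeriv
  refine Measurable.liminf fun m => ?_
  exact measurable_const.mul ((hterm _).sub (hterm _))

/-- On `(ℝ²)^k`: `x ↦ seqDeriv (r ↦ f(x + r e₁^{(j)})) 0` (difference quotient in coordinate `j`
along `e₁`) is measurable for measurable `f`. [folklore] -/
theorem measurable_seqDeriv_update {k : ℕ} {f : (Fin k → EuclideanSpace ℝ (Fin 2)) → ℝ}
    (hf : Measurable f) (j : Fin k) :
    Measurable fun x : Fin k → EuclideanSpace ℝ (Fin 2) =>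
      seqDeriv (fun r => f (update x j (x j + r • EuclideanSpace.single 0 (1 : ℝ)))) 0 := by
  have hterm : ∀ c : ℝ, Measurable fun x : Fin k → EuclideanSpace ℝ (Fin 2) =>
      f (update x j (x j + c • EuclideanSpace.single 0 (1 : ℝ))) := fun c =>
    hf.comp (measurable_update'.comp (measurable_id.prodMk ((measurable_pi_apply j).add_const _)))
  unfold seqDeriv
  refine Measurable.liminf fun m => ?_
  exact measurable_const.mul ((hterm _).sub (hterm _))

/-- The shear map is measurable. [folklore] -/
theorem measurable_shearMap {k : ℕ} {t : Fin k → (Fin k → EuclideanSpace ℝ (Fin 2)) → ℝ}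
    (hm : ∀ j, Measurable (t j)) : Measurable (shearMap t) :=
  measurable_pi_lambda _ fun j => (measurable_pi_apply j).add ((hm j).smul_const _)

/-- The Jacobian factor is measurable. [folklore] -/
theorem measurable_shearJacobian {k : ℕ} {t : Fin k → (Fin k → EuclideanSpace ℝ (Fin 2)) → ℝ}
    (hm : ∀ j, Measurable (t j)) : Measurable (shearJacobian t) :=
  Finset.measurable_prod _ fun j _ =>
    ENNReal.measurable_ofReal.comp (measurable_const.add (measurable_seqDeriv_update (hm j) j))

/-- `(p, x') ↦ p :: x'` is measurable. [folklore] -/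
theorem measurable_finCons (k : ℕ) :
    Measurable fun q : EuclideanSpace ℝ (Fin 2) × (Fin k → EuclideanSpace ℝ (Fin 2)) =>
      (Fin.cons q.1 q.2 : Fin (k + 1) → EuclideanSpace ℝ (Fin 2)) :=
  measurable_pi_lambda _ fun j => Fin.cases (by simp only [Fin.cons_zero]; exact measurable_fst)
    (fun i => by simp only [Fin.cons_succ]; exact (measurable_pi_apply i).comp measurable_snd) j

/-- `tailShear t` is measurable. [folklore] -/
theorem measurable_tailShear {k : ℕ} {t : Fin (k + 1) → (Fin (k + 1) → EuclideanSpace ℝ (Fin 2)) → ℝ}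
    (hm : ∀ j, Measurable (t j)) (i : Fin k) : Measurable (tailShear t i) :=
  (hm i.succ).comp ((measurable_finCons k).comp (measurable_const.prodMk measurable_id))

/-- `headShear t` is jointly measurable. [folklore] -/
theorem measurable_headShear {k : ℕ} {t : Fin (k + 1) → (Fin (k + 1) → EuclideanSpace ℝ (Fin 2)) → ℝ}
    (hm : ∀ j, Measurable (t j)) :
    Measurable fun q : (Fin k → EuclideanSpace ℝ (Fin 2)) × EuclideanSpace ℝ (Fin 2) =>
      headShear t q.1 q.2 :=
  (hm 0).comp ((measurable_finCons k).comp measurable_swap)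

/-- The planar integrand `(x', p) ↦ (1 + ∂₁ᵉ s(x', p)) w(x', p + s(x', p) e₁)` is jointly
measurable for jointly measurable `s`, `w`. [folklore] -/
theorem measurable_planarIntegrand {X : Type*} [MeasurableSpace X]
    {s : X → EuclideanSpace ℝ (Fin 2) → ℝ}
    (hs : Measurable fun q : X × EuclideanSpace ℝ (Fin 2) => s q.1 q.2)
    {w : X × EuclideanSpace ℝ (Fin 2) → ℝ≥0∞} (hw : Measurable w) :
    Measurable fun q : X × EuclideanSpace ℝ (Fin 2) =>
      ENNReal.ofReal (1 + seqDeriv (fun r => s q.1 (q.2 + r • EuclideanSpace.single 0 (1 : ℝ))) 0) *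
        w (q.1, q.2 + s q.1 q.2 • EuclideanSpace.single 0 (1 : ℝ)) := by
  refine (ENNReal.measurable_ofReal.comp (measurable_const.add ?_)).mul
    (hw.comp (measurable_fst.prodMk (measurable_snd.add (hs.smul_const _))))
  have hterm : ∀ c : ℝ, Measurable fun q : X × EuclideanSpace ℝ (Fin 2) =>
      s q.1 (q.2 + c • EuclideanSpace.single 0 (1 : ℝ)) := fun c =>
    hs.comp (measurable_fst.prodMk (measurable_snd.add_const _))
  unfold seqDeriv
  refine Measurable.liminf fun m => ?_
  exact measurable_const.mul ((hterm _).sub (hterm _))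

/-! ### Triangular systems split along `x = p :: x'` -/

/-- For triangular `t`, the later translations do not see coordinate `0`:
`t_{i+1}(p :: x') = tailShear t i x'`. [folklore] -/
theorem apply_succ_cons_eq_tailShear {k : ℕ}
    {t : Fin (k + 1) → (Fin (k + 1) → EuclideanSpace ℝ (Fin 2)) → ℝ}
    (htri : ∀ j x x', (∀ i, j ≤ i → x i = x' i) → t j x = t j x')
    (i : Fin k) (p : EuclideanSpace ℝ (Fin 2)) (x' : Fin k → EuclideanSpace ℝ (Fin 2)) :
    t i.succ (Fin.cons p x') = tailShear t i x' := by
  refine htri i.succ _ _ fun l hl => ?_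
  refine Fin.cases (fun h => ?_) (fun l' _ => ?_) l hl
  · exact absurd (lt_of_lt_of_le (Fin.succ_pos i) h) (lt_irrefl _)
  · simp only [Fin.cons_succ]

/-- **The shear map splits**: `shearMap t (p :: x') = (p + headShear t x' p · e₁) ::
shearMap (tailShear t) x'` for triangular `t`. [cite: Richthammer2007, §6.6 (p. 16)] -/
theorem shearMap_cons {k : ℕ} {t : Fin (k + 1) → (Fin (k + 1) → EuclideanSpace ℝ (Fin 2)) → ℝ}
    (htri : ∀ j x x', (∀ i, j ≤ i → x i = x' i) → t j x = t j x')
    (p : EuclideanSpace ℝ (Fin 2)) (x' : Fin k → EuclideanSpace ℝ (Fin 2)) :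
    shearMap t (Fin.cons p x') =
      Fin.cons (p + headShear t x' p • EuclideanSpace.single 0 (1 : ℝ)) (shearMap (tailShear t) x') := by
  funext j
  refine Fin.cases ?_ (fun i => ?_) j
  · simp only [shearMap, Fin.cons_zero, headShear]
  · simp only [shearMap, Fin.cons_succ, apply_succ_cons_eq_tailShear htri]

/-- **The Jacobian splits**: `shearJacobian t (p :: x') =
(1 + ∂₁ᵉ (headShear t x') (p)) · shearJacobian (tailShear t) x'` for triangular `t`.
[cite: Richthammer2007, §6.6 (p. 16)] -/
theorem shearJacobian_cons {k : ℕ} {t : Fin (k + 1) → (Fin (k + 1) → EuclideanSpace ℝ (Fin 2)) → ℝ}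
    (htri : ∀ j x x', (∀ i, j ≤ i → x i = x' i) → t j x = t j x')
    (p : EuclideanSpace ℝ (Fin 2)) (x' : Fin k → EuclideanSpace ℝ (Fin 2)) :
    shearJacobian t (Fin.cons p x') =
      ENNReal.ofReal (1 + seqDeriv (fun r =>
        headShear t x' (p + r • EuclideanSpace.single 0 (1 : ℝ))) 0) *
        shearJacobian (tailShear t) x' := by
  rw [shearJacobian, shearJacobian, Fin.prod_univ_succ]
  congr 1
  · simp only [Fin.cons_zero, Fin.update_cons_zero, headShear]
  · refine Finset.prod_congr rfl fun i _ => ?_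
    simp only [Fin.cons_succ, ← Fin.cons_update, apply_succ_cons_eq_tailShear htri]

/-- `tailShear t` is triangular if `t` is. [folklore] -/
theorem triangular_tailShear {k : ℕ} {t : Fin (k + 1) → (Fin (k + 1) → EuclideanSpace ℝ (Fin 2)) → ℝ}
    (htri : ∀ j x x', (∀ i, j ≤ i → x i = x' i) → t j x = t j x')
    (i : Fin k) (x' x'' : Fin k → EuclideanSpace ℝ (Fin 2)) (h : ∀ l, i ≤ l → x' l = x'' l) :
    tailShear t i x' = tailShear t i x'' := by
  refine htri i.succ _ _ fun l hl => ?_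
  refine Fin.cases (fun _ => rfl) (fun l' hl' => ?_) l hl
  simp only [Fin.cons_succ, h l' (Fin.succ_le_succ_iff.1 hl')]

/-- `tailShear t` inherits the Lipschitz property along `e₁`. [folklore] -/
theorem lipschitz_tailShear {k : ℕ} {L : ℝ≥0}
    {t : Fin (k + 1) → (Fin (k + 1) → EuclideanSpace ℝ (Fin 2)) → ℝ}
    (hlip : ∀ j x, LipschitzWith L fun r : ℝ =>
      t j (update x j (x j + r • EuclideanSpace.single 0 (1 : ℝ))))
    (i : Fin k) (x' : Fin k → EuclideanSpace ℝ (Fin 2)) :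
    LipschitzWith L fun r : ℝ =>
      tailShear t i (update x' i (x' i + r • EuclideanSpace.single 0 (1 : ℝ))) := by
  have h := hlip i.succ (Fin.cons 0 x')
  simp only [Fin.cons_succ, ← Fin.cons_update] at h
  exact h

/-- `headShear t x'` inherits the Lipschitz property along `e₁`. [folklore] -/
theorem lipschitz_headShear {k : ℕ} {L : ℝ≥0}
    {t : Fin (k + 1) → (Fin (k + 1) → EuclideanSpace ℝ (Fin 2)) → ℝ}
    (hlip : ∀ j x, LipschitzWith L fun r : ℝ =>
      t j (update x j (x j + r • EuclideanSpace.single 0 (1 : ℝ))))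
    (x' : Fin k → EuclideanSpace ℝ (Fin 2)) (p : EuclideanSpace ℝ (Fin 2)) :
    LipschitzWith L fun r : ℝ => headShear t x' (p + r • EuclideanSpace.single 0 (1 : ℝ)) := by
  have h := hlip 0 (Fin.cons p x')
  simp only [Fin.cons_zero, Fin.update_cons_zero] at h
  exact h

/-! ### Splitting off coordinate `0` of `(ℝ²)^{k+1}` -/

/-- Tonelli for `λ^{⊗(k+1)} = λ ⊗ λ^{⊗k}` on `(ℝ²)^{k+1}`, coordinate `0` innermost:
`∫ g = ∫ dx' ∫ dp g(p :: x')`. [folklore] -/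
theorem lintegral_pi_succ_eq_lintegral_lintegral_cons_inner (k : ℕ)
    {g : (Fin (k + 1) → EuclideanSpace ℝ (Fin 2)) → ℝ≥0∞} (hg : Measurable g) :
    ∫⁻ x, g x ∂(Measure.pi fun _ : Fin (k + 1) => (volume : Measure (EuclideanSpace ℝ (Fin 2)))) =
      ∫⁻ x', ∫⁻ p, g (Fin.cons p x') ∂(volume : Measure (EuclideanSpace ℝ (Fin 2)))
        ∂(Measure.pi fun _ : Fin k => (volume : Measure (EuclideanSpace ℝ (Fin 2)))) := by
  have hmp := MeasurePreserving.symm _ (measurePreserving_piFinSuccAbove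
    (fun _ : Fin (k + 1) => (volume : Measure (EuclideanSpace ℝ (Fin 2)))) 0)
  rw [← hmp.lintegral_comp hg,
    lintegral_prod_symm (fun q : EuclideanSpace ℝ (Fin 2) × (Fin k → EuclideanSpace ℝ (Fin 2)) =>
      g ((MeasurableEquiv.piFinSuccAbove (fun _ => EuclideanSpace ℝ (Fin 2)) 0).symm q))
      ((hg.comp hmp.measurable).aemeasurable)]
  refine lintegral_congr fun x' => lintegral_congr fun p => ?_
  rw [MeasurableEquiv.piFinSuccAbove_symm_apply]
  simp [Fin.insertNthEquiv, Fin.insertNth_zero']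

/-! ### The iterated substitution -/

/-- The integrand splits along `x = p :: x'` (pointwise form of the inductive step).
[cite: Richthammer2007, §6.6 (p. 16)] -/
theorem shearJacobian_mul_comp_shearMap_cons {k : ℕ}
    {t : Fin (k + 1) → (Fin (k + 1) → EuclideanSpace ℝ (Fin 2)) → ℝ}
    (htri : ∀ j x x', (∀ i, j ≤ i → x i = x' i) → t j x = t j x')
    (u : (Fin (k + 1) → EuclideanSpace ℝ (Fin 2)) → ℝ≥0∞)
    (p : EuclideanSpace ℝ (Fin 2)) (x' : Fin k → EuclideanSpace ℝ (Fin 2)) :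
    shearJacobian t (Fin.cons p x') * u (shearMap t (Fin.cons p x')) =
      shearJacobian (tailShear t) x' *
        (ENNReal.ofReal (1 + seqDeriv (fun r =>
          headShear t x' (p + r • EuclideanSpace.single 0 (1 : ℝ))) 0) *
          u (Fin.cons (p + headShear t x' p • EuclideanSpace.single 0 (1 : ℝ))
            (shearMap (tailShear t) x'))) := by
  rw [shearJacobian_cons htri, shearMap_cons htri, ← mul_assoc,
    mul_comm (ENNReal.ofReal _) (shearJacobian (tailShear t) x')]

/-- The inner integral over coordinate `0` is computed by the planar rule:
`∫ dp shearJacobian t (p :: x') u(shearMap t (p :: x')) =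
shearJacobian (tailShear t)(x') ∫ dp u(p :: shearMap (tailShear t) x')`.
[cite: Richthammer2007, §6.6 (p. 16)] -/
theorem lintegral_shearJacobian_mul_comp_shearMap_cons {k : ℕ} {L : ℝ≥0} (hL1 : L < 1)
    {t : Fin (k + 1) → (Fin (k + 1) → EuclideanSpace ℝ (Fin 2)) → ℝ}
    (hm : ∀ j, Measurable (t j))
    (htri : ∀ j x x', (∀ i, j ≤ i → x i = x' i) → t j x = t j x')
    (hlip : ∀ j x, LipschitzWith L fun r : ℝ =>
      t j (update x j (x j + r • EuclideanSpace.single 0 (1 : ℝ))))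
    {u : (Fin (k + 1) → EuclideanSpace ℝ (Fin 2)) → ℝ≥0∞} (hu : Measurable u)
    (x' : Fin k → EuclideanSpace ℝ (Fin 2)) :
    ∫⁻ p, shearJacobian t (Fin.cons p x') * u (shearMap t (Fin.cons p x'))
        ∂(volume : Measure (EuclideanSpace ℝ (Fin 2))) =
      shearJacobian (tailShear t) x' *
        ∫⁻ p, u (Fin.cons p (shearMap (tailShear t) x')) ∂(volume : Measure (EuclideanSpace ℝ (Fin 2))) := by
  have hT'm : Measurable (shearMap (tailShear t)) := measurable_shearMap (measurable_tailShear hm)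
  have hpair : Measurable fun p : EuclideanSpace ℝ (Fin 2) =>
      ((x', p) : (Fin k → EuclideanSpace ℝ (Fin 2)) × EuclideanSpace ℝ (Fin 2)) :=
    measurable_const.prodMk measurable_id
  have hhm : Measurable (headShear t x') := (measurable_headShear hm).comp hpair
  have hum : Measurable fun p : EuclideanSpace ℝ (Fin 2) =>
      u (Fin.cons p (shearMap (tailShear t) x')) :=
    hu.comp ((measurable_finCons k).comp (measurable_id.prodMk measurable_const))
  have hps := lintegral_planarShear hhm (lipschitz_headShear hlip x') hL1 hum
  beta_reduce at hps
  have hmeas : Measurable fun p : EuclideanSpace ℝ (Fin 2) =>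
      ENNReal.ofReal (1 + seqDeriv (fun r =>
        headShear t x' (p + r • EuclideanSpace.single 0 (1 : ℝ))) 0) *
      u (Fin.cons (p + headShear t x' p • EuclideanSpace.single 0 (1 : ℝ))
        (shearMap (tailShear t) x')) :=
    (ENNReal.measurable_ofReal.comp (measurable_const.add (measurable_seqDeriv_line hhm))).mul
      (hum.comp (measurable_id.add (hhm.smul_const _)))
  rw [← hps, ← lintegral_const_mul _ hmeas]
  exact lintegral_congr fun p => shearJacobian_mul_comp_shearMap_cons htri u p x'

/-- The inductive step: `∫ shearJacobian t · u ∘ shearMap t =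
∫ dx' shearJacobian (tailShear t)(x') ∫ dp u(p :: shearMap (tailShear t) x')`.
[cite: Richthammer2007, §6.6 (p. 16)] -/
theorem lintegral_shearJacobian_mul_comp_shearMap_succ {k : ℕ} {L : ℝ≥0} (hL1 : L < 1)
    {t : Fin (k + 1) → (Fin (k + 1) → EuclideanSpace ℝ (Fin 2)) → ℝ}
    (hm : ∀ j, Measurable (t j))
    (htri : ∀ j x x', (∀ i, j ≤ i → x i = x' i) → t j x = t j x')
    (hlip : ∀ j x, LipschitzWith L fun r : ℝ =>
      t j (update x j (x j + r • EuclideanSpace.single 0 (1 : ℝ))))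
    {u : (Fin (k + 1) → EuclideanSpace ℝ (Fin 2)) → ℝ≥0∞} (hu : Measurable u) :
    ∫⁻ x, shearJacobian t x * u (shearMap t x)
        ∂(Measure.pi fun _ : Fin (k + 1) => (volume : Measure (EuclideanSpace ℝ (Fin 2)))) =
      ∫⁻ x', shearJacobian (tailShear t) x' *
        ∫⁻ p, u (Fin.cons p (shearMap (tailShear t) x')) ∂(volume : Measure (EuclideanSpace ℝ (Fin 2)))
        ∂(Measure.pi fun _ : Fin k => (volume : Measure (EuclideanSpace ℝ (Fin 2)))) := by
  have hΦm : Measurable fun x => shearJacobian t x * u (shearMap t x) :=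
    (measurable_shearJacobian hm).mul (hu.comp (measurable_shearMap hm))
  rw [lintegral_pi_succ_eq_lintegral_lintegral_cons_inner k hΦm]
  exact lintegral_congr fun x' =>
    lintegral_shearJacobian_mul_comp_shearMap_cons hL1 hm htri hlip hu x'

/-- **Change of variables for a triangular system of planar shears** (Richthammer 2007, §6.6,
the computation of `I(k, π)`). Let `t : Fin k → ((ℝ²)^k → ℝ)` be measurable, triangular —
`t j x` depends only on the coordinates `x i` with `i ≥ j` — and `L`-Lipschitz, `L < 1`, along
`e₁` in coordinate `j`. Then for every measurable `u : (ℝ²)^k → [0, ∞]`: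
`∫ shearJacobian t (x) u(shearMap t x) dx = ∫ u(x') dx'`, i.e.
`∫ ∏_j (1 + ∂₁ᵉ_j t_j(x)) u((x_j + t_j(x) e₁)_j) dx = ∫ u`.
[cite: Richthammer2007, §6.6 (p. 16)] -/
theorem lintegral_shearJacobian_mul_comp_shearMap {L : ℝ≥0} (hL1 : L < 1) :
    ∀ (k : ℕ) (t : Fin k → (Fin k → EuclideanSpace ℝ (Fin 2)) → ℝ),
      (∀ j, Measurable (t j)) →
      (∀ j x x', (∀ i, j ≤ i → x i = x' i) → t j x = t j x') →
      (∀ j x, LipschitzWith L fun r : ℝ =>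
        t j (update x j (x j + r • EuclideanSpace.single 0 (1 : ℝ)))) →
      ∀ u : (Fin k → EuclideanSpace ℝ (Fin 2)) → ℝ≥0∞, Measurable u →
        ∫⁻ x, shearJacobian t x * u (shearMap t x)
            ∂(Measure.pi fun _ : Fin k => (volume : Measure (EuclideanSpace ℝ (Fin 2)))) =
          ∫⁻ x, u x ∂(Measure.pi fun _ : Fin k => (volume : Measure (EuclideanSpace ℝ (Fin 2)))) := by
  intro k
  induction k with
  | zero =>
    intro t _ _ _ u _
    refine lintegral_congr fun x => ?_
    rw [shearJacobian, Finset.univ_eq_empty, Finset.prod_empty, one_mul]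
    exact congrArg u (Subsingleton.elim _ _)
  | succ k ih =>
    intro t hm htri hlip u hu
    have hvm : Measurable fun y' : Fin k → EuclideanSpace ℝ (Fin 2) =>
        ∫⁻ p, u (Fin.cons p y') ∂(volume : Measure (EuclideanSpace ℝ (Fin 2))) :=
      (hu.comp ((measurable_finCons k).comp measurable_swap)).lintegral_prod_right'
    rw [lintegral_shearJacobian_mul_comp_shearMap_succ hL1 hm htri hlip hu,
      ih (tailShear t) (measurable_tailShear hm) (triangular_tailShear htri)
        (lipschitz_tailShear hlip) _ hvm,
      lintegral_pi_succ_eq_lintegral_lintegral_cons_inner k hu]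

/-! ### Any selection order -/

/-- Relabelling the coordinates by a permutation `π`: `(Φ_π y) i = y (π⁻¹ i)`. [folklore] -/
theorem piCongrLeft_const_apply {k : ℕ} (π : Equiv.Perm (Fin k))
    (y : Fin k → EuclideanSpace ℝ (Fin 2)) (i : Fin k) :
    MeasurableEquiv.piCongrLeft (fun _ : Fin k => EuclideanSpace ℝ (Fin 2)) π y i = y (π.symm i) := by
  have h := MeasurableEquiv.piCongrLeft_apply_apply π (β := fun _ : Fin k => EuclideanSpace ℝ (Fin 2))
    y (π.symm i)
  rwa [Equiv.apply_symm_apply] at h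

/-- **Change of variables for a system of planar shears that is triangular in SOME order.** If
`t : Fin k → ((ℝ²)^k → ℝ)` is measurable, `L`-Lipschitz (`L < 1`) along `e₁` in each coordinate,
and triangular with respect to a selection order `π` — `t (π j) x` depends only on the
coordinates `x (π i)`, `i ≥ j` (the particle `π 0` is selected last) — then
`∫ shearJacobian t · u ∘ shearMap t = ∫ u` for every measurable `u ≥ 0` (relabel the particles by
`π`, `MeasureTheory.measurePreserving_piCongrLeft`, and apply the standard-order theorem). This
is the form used cell by cell (`A_π`, `π ∈ Π`) in Richthammer's computation of `I(k) = ∑_π I(k, π)`.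
[cite: Richthammer2007, §6.6 (p. 16)] -/
theorem lintegral_shearJacobian_mul_comp_shearMap_of_perm {k : ℕ} {L : ℝ≥0} (hL1 : L < 1)
    (π : Equiv.Perm (Fin k)) {t : Fin k → (Fin k → EuclideanSpace ℝ (Fin 2)) → ℝ}
    (hm : ∀ j, Measurable (t j))
    (htri : ∀ j x x', (∀ i, j ≤ i → x (π i) = x' (π i)) → t (π j) x = t (π j) x')
    (hlip : ∀ j x, LipschitzWith L fun r : ℝ =>
      t j (update x j (x j + r • EuclideanSpace.single 0 (1 : ℝ))))
    {u : (Fin k → EuclideanSpace ℝ (Fin 2)) → ℝ≥0∞} (hu : Measurable u) :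
    ∫⁻ x, shearJacobian t x * u (shearMap t x)
        ∂(Measure.pi fun _ : Fin k => (volume : Measure (EuclideanSpace ℝ (Fin 2)))) =
      ∫⁻ x, u x ∂(Measure.pi fun _ : Fin k => (volume : Measure (EuclideanSpace ℝ (Fin 2)))) := by
  classical
  -- the relabelling `Φ y = y ∘ π⁻¹` and the relabelled data
  set Φ : (Fin k → EuclideanSpace ℝ (Fin 2)) ≃ᵐ (Fin k → EuclideanSpace ℝ (Fin 2)) :=
    MeasurableEquiv.piCongrLeft (fun _ : Fin k => EuclideanSpace ℝ (Fin 2)) π with hΦ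
  have hΦapply : ∀ y i, Φ y i = y (π.symm i) := piCongrLeft_const_apply π
  have hΦmp : MeasurePreserving Φ
      (Measure.pi fun _ : Fin k => (volume : Measure (EuclideanSpace ℝ (Fin 2))))
      (Measure.pi fun _ : Fin k => (volume : Measure (EuclideanSpace ℝ (Fin 2)))) :=
    measurePreserving_piCongrLeft (fun _ : Fin k => (volume : Measure (EuclideanSpace ℝ (Fin 2)))) π
  have hΦfun : ∀ y, (Φ y : Fin k → EuclideanSpace ℝ (Fin 2)) = fun i => y (π.symm i) :=
    fun y => funext (hΦapply y)
  set t' : Fin k → (Fin k → EuclideanSpace ℝ (Fin 2)) → ℝ := fun j y => t (π j) (Φ y) with ht'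
  -- hypotheses for the relabelled data
  have hm' : ∀ j, Measurable (t' j) := fun j => (hm (π j)).comp Φ.measurable
  have htri' : ∀ j y y', (∀ i, j ≤ i → y i = y' i) → t' j y = t' j y' := by
    intro j y y' h
    refine htri j _ _ fun i hi => ?_
    rw [hΦapply, hΦapply, Equiv.symm_apply_apply, h i hi]
  have hupd : ∀ (y : Fin k → EuclideanSpace ℝ (Fin 2)) (j : Fin k) (v : EuclideanSpace ℝ (Fin 2)),
      (Φ (update y j v) : Fin k → EuclideanSpace ℝ (Fin 2)) = update (Φ y) (π j) v := by
    intro y j v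
    rw [hΦfun, hΦfun]
    have h := Function.update_comp_equiv y π.symm j v
    rw [Equiv.symm_symm] at h
    exact h
  have hlip' : ∀ j y, LipschitzWith L fun r : ℝ =>
      t' j (update y j (y j + r • EuclideanSpace.single 0 (1 : ℝ))) := by
    intro j y
    have h := hlip (π j) (Φ y)
    have heq : (fun r : ℝ => t (π j) (update (Φ y) (π j)
        ((Φ y : Fin k → EuclideanSpace ℝ (Fin 2)) (π j) + r • EuclideanSpace.single 0 (1 : ℝ)))) =
        fun r => t' j (update y j (y j + r • EuclideanSpace.single 0 (1 : ℝ))) := by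
      funext r
      simp only [ht', hupd, hΦapply, Equiv.symm_apply_apply]
    rwa [heq] at h
  -- the relabelled shear map and Jacobian
  have hmap : ∀ y, shearMap t (Φ y) = Φ (shearMap t' y) := fun y => by
    funext i
    rw [hΦapply, shearMap_apply, shearMap_apply, hΦapply, ht']
    simp only [Equiv.apply_symm_apply]
  have hjac : ∀ y, shearJacobian t (Φ y) = shearJacobian t' y := fun y => by
    rw [shearJacobian_def, shearJacobian_def]
    refine (Fintype.prod_equiv π _ _ fun j => ?_).symm
    simp only [ht', hupd, hΦapply, Equiv.symm_apply_apply]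
  -- transport, apply the standard-order theorem, transport back
  have hF : Measurable fun x => shearJacobian t x * u (shearMap t x) :=
    (measurable_shearJacobian hm).mul (hu.comp (measurable_shearMap hm))
  have hu' : Measurable fun z => u (Φ z) := hu.comp Φ.measurable
  calc ∫⁻ x, shearJacobian t x * u (shearMap t x)
          ∂(Measure.pi fun _ : Fin k => (volume : Measure (EuclideanSpace ℝ (Fin 2))))
      = ∫⁻ y, shearJacobian t (Φ y) * u (shearMap t (Φ y))
          ∂(Measure.pi fun _ : Fin k => (volume : Measure (EuclideanSpace ℝ (Fin 2)))) :=
        (hΦmp.lintegral_comp hF).symm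
    _ = ∫⁻ y, shearJacobian t' y * u (Φ (shearMap t' y))
          ∂(Measure.pi fun _ : Fin k => (volume : Measure (EuclideanSpace ℝ (Fin 2)))) := by
        refine lintegral_congr fun y => ?_
        rw [hjac, hmap]
    _ = ∫⁻ z, u (Φ z) ∂(Measure.pi fun _ : Fin k => (volume : Measure (EuclideanSpace ℝ (Fin 2)))) :=
        lintegral_shearJacobian_mul_comp_shearMap hL1 k t' hm' htri' hlip' _ hu'
    _ = ∫⁻ x, u x ∂(Measure.pi fun _ : Fin k => (volume : Measure (EuclideanSpace ℝ (Fin 2)))) :=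
        hΦmp.lintegral_comp hu

end Literature.MeasureTheory.Lebesgue

end
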